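import Literature.AlgebraicGeometry.GroupSchemes.EtaleComplementSplitsUnitComponent   -- ★ (o-c3j) `isIso_tensorHom_comp_mul_of_etale`
import Literature.AlgebraicGeometry.GroupSchemes.ConnectedFactorsThroughUnitComponent  -- ★ (o-c2d) `existsUnique_fac_hom`
import Literature.AlgebraicGeometry.GroupSchemes.EtaleGroupSchemeConstant              -- ★ `hom_ext_of_sections`
import Literature.AlgebraicGeometry.GroupSchemes.IsIsoOrEtaleOfNatCard                 -- ★ (O-b1k) `finrank_alg_eq_natCard_sections_mul`, `hom_finrank_eq_finrank_alg`
import Literature.AlgebraicGeometry.GroupSchemes.HopfIdealOfFiniteSubgroupOfPoints     -- ★ `exists_etale_closedSubgroup_of_points`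
import Literature.AlgebraicGeometry.GroupSchemes.FrobeniusKillsQuotientSupersingular   -- ★ `FrobKillSS.surjective_pi_ptEquiv_of_injective`
import Literature.AlgebraicGeometry.GroupSchemes.UnitComponentClopen                   -- ★ `UnitComponentClopen.exists_unitComponent`
import HarnessLib

/-!
# The connected–étale idempotent of a finite commutative group scheme over an algebraically closed field
# ([Tate 1997] (3.7): `G = G⁰ × G_ét` over a perfect field; the projection onto `G⁰` as an idempotent endomorphism)

Topic `Literature/AlgebraicGeometry/GroupSchemes`; namespace `Literature.AlgebraicGeometry.GroupSchemes`.  THEOREMS ONLY plus ONE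
categorical `def` (`SplitIdempotent.idem`, the idempotent of a product splitting), its `abbrev mulMap`, one data record `structure
ConnectedEtaleSplitting` (group structures as fields) and the `def ConnectedEtaleSplitting.idem`; no named fact, no instance, no notation, no `sorry`.  Cell `hodgecm-mathlib` (D-0151), P6 «MOD programme», sub-desk F0P6b
«ONE-DIMENSIONAL BLOCK NUMERICS» kit (`Lines/F0_P6b_BlockNumerics.lean`), organ (n0) «CONNECTED PART OF A BT GROUP OVER AN ALGEBRAICALLY
CLOSED FIELD», FILE A: the layer-wise idempotent.  HC_CM is proved only modulo the printed citations until rung 0 closes; nothing here is about HC.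

THE PRINT.  [Tate1997FiniteFlatGroupSchemes] (3.7): for a finite flat group scheme `G` over a henselian local base the unit component `G⁰` is an
open and closed subgroup scheme and `G ∕ G⁰ = G_ét` is étale; over a PERFECT FIELD the sequence `0 → G⁰ → G → G_ét → 0` SPLITS canonically,
`G_red ⥲ G_ét`, so `G = G⁰ × G_ét` functorially in `G`.  Consequently the composite `ε_G : G ↠ G⁰ ↪ G` (projection along `G_red`) is an
IDEMPOTENT ENDOMORPHISM of `G`, natural in `G`, with fixed subscheme `G⁰` and kernel `G_red`.  [Waterhouse1979] §6.8 (the same over a perfect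
field, Hopf-algebra form `A = A⁰ ⊗ A_ét`).  We work over an ALGEBRAICALLY CLOSED field `k` (where `G_red` is the constant subgroup scheme of all
`k`-points, ★ `exists_etale_closedSubgroup_of_points`) and with COMMUTATIVE `G` (so that `ε_G` is a homomorphism).

MAIN STATEMENTS.
* §1 (categorical core, any cartesian monoidal category): for homomorphisms `j : G₀ → G`, `i : H → G` of group objects with
  `m := (i ⊗ j) ≫ μ : H ⊗ G₀ → G` an isomorphism, `SplitIdempotent.idem j i := m⁻¹ ≫ pr₂ ≫ j` satisfies `j ≫ idem = j`, `i ≫ idem = 1`,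
  `idem ≫ idem = idem`, «`t ≫ idem = t ↔ t` factors through `j`» (`comp_idem_eq_self_iff`), is a homomorphism when `G` is commutative, and is
  NATURAL: `φ ≫ idem' = idem ≫ φ` for a homomorphism `φ : G → G'` carrying `G₀` into `G₀'` and `H` to the unit of the `G₀'`-projection
  (`comp_idem_eq_idem_comp`).  ONE `def` (`idem`) and one `abbrev` (`mulMap`).
* §2 (over `k = k̄`): `exists_etaleComplement` — next to a unit component `j : G₀ ↪ G` of a finite group scheme there is a closed ÉTALE subgroup
  `i : H ↪ G` of complementary rank `rk H · rk G₀ = rk G` (the subgroup of all `k`-points); `subsingleton_sections_of_connectedSpace` (a connected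
  finite `k`-group has exactly one `k`-point); `comp_idem_eq_idem_comp_of_hom` — naturality of the idempotent for EVERY homomorphism `G → G'`
  between finite commutative `k`-groups so split; §3 `exists_connectedEtaleIdempotent` — the packaged existence: an idempotent homomorphic
  endomorphism `ε` of `G` whose fixed points are exactly the points of the unit component.
CONSUMER: FILE B `BarsottiTateGroupConnectedPart` (the layers' idempotents assemble to an idempotent endomorphism of a Barsotti–Tate group over
`k̄`, whose fixed part ★ `BTGroup.Hom.fixBTGroup` is the CONNECTED PART `B⁰`).

## References
* [Tate1997FiniteFlatGroupSchemes] J. Tate, *Finite flat group schemes*, in: Modular Forms and Fermat's Last Theorem (Springer, 1997), (3.7),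
  pp. 138–141.
* [Waterhouse1979] W. C. Waterhouse, *Introduction to Affine Group Schemes*, GTM 66 (Springer, 1979), §6.8 (p. 52).
* [Tate1967] J. T. Tate, *p-divisible groups*, Proc. Conf. Local Fields (Driebergen, 1966), Springer (1967), §2.2 / (2.4) `G = G⁰`-`G^{ét}`.
-/

set_option autoImplicit false

noncomputable section

universe v u

open CategoryTheory CategoryTheory.Limits AlgebraicGeometry MonoidalCategory CartesianMonoidalCategory
open scoped MonObj

namespace Literature.AlgebraicGeometry.GroupSchemes

/-! ## §1 The categorical core: the idempotent of a product splitting `H ⊗ G₀ ⥲ G` -/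

namespace SplitIdempotent

section Core

variable {C : Type u} [Category.{v} C] [CartesianMonoidalCategory C]
variable {G G₀ H : C} [GrpObj G] (j : G₀ ⟶ G) (i : H ⟶ G)

/-- The multiplication map `m := (i ⊗ j) ≫ μ_G : H ⊗ G₀ ⟶ G` of two morphisms into a group object. [cite: Tate1997FiniteFlatGroupSchemes, (3.7)] -/
abbrev mulMap : H ⊗ G₀ ⟶ G := (i ⊗ₘ j) ≫ μ[G]

/-- `(1, id) ≫ m = j`: the second factor enters `m` through `j`. [cite: Tate1997FiniteFlatGroupSchemes, (3.7)] -/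
theorem lift_one_id_comp_mulMap [MonObj H] [IsMonHom i] : lift (1 : G₀ ⟶ H) (𝟙 G₀) ≫ mulMap j i = j := by
  rw [mulMap, lift_map_assoc, MonObj.one_comp, Category.id_comp, Hom.one_def, MonObj.lift_comp_one_left]

/-- `(id, 1) ≫ m = i`: the first factor enters `m` through `i`. [cite: Tate1997FiniteFlatGroupSchemes, (3.7)] -/
theorem lift_id_one_comp_mulMap [MonObj G₀] [IsMonHom j] : lift (𝟙 H) (1 : H ⟶ G₀) ≫ mulMap j i = i := by
  rw [mulMap, lift_map_assoc, MonObj.one_comp, Category.id_comp, Hom.one_def, MonObj.lift_comp_one_right]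

variable [IsIso (mulMap j i)]

/-- **THE IDEMPOTENT OF A SPLITTING**: `ε := m⁻¹ ≫ pr₂ ≫ j : G ⟶ G` — identify `G ≅ H ⊗ G₀` by `m`, project to the `G₀`-factor, include it back.
For `G` a finite commutative group scheme over a perfect field, `j` its unit component and `i` the étale part, this is the projection of
`G = G⁰ × G_ét` onto `G⁰`. [cite: Tate1997FiniteFlatGroupSchemes, (3.7)] [cite: Waterhouse1979, §6.8] -/
def idem : G ⟶ G := inv (mulMap j i) ≫ snd H G₀ ≫ j

/-- `m ≫ ε = pr₂ ≫ j`. [cite: Tate1997FiniteFlatGroupSchemes, (3.7)] -/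
theorem mulMap_comp_idem : mulMap j i ≫ idem j i = snd H G₀ ≫ j := by
  rw [idem, IsIso.hom_inv_id_assoc]

/-- A point factoring through `j` is FIXED by `ε`. [cite: Tate1997FiniteFlatGroupSchemes, (3.7)] -/
theorem comp_idem_of_fac [MonObj H] [IsMonHom i] {T : C} (t : T ⟶ G) (t₀ : T ⟶ G₀) (ht : t₀ ≫ j = t) : t ≫ idem j i = t := by
  have h1 : t ≫ inv (mulMap j i) = t₀ ≫ lift (1 : G₀ ⟶ H) (𝟙 G₀) := by
    rw [← cancel_mono (mulMap j i), Category.assoc, IsIso.inv_hom_id, Category.comp_id, Category.assoc,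
      lift_one_id_comp_mulMap, ht]
  rw [idem, ← Category.assoc, h1, Category.assoc, lift_snd_assoc, Category.id_comp, ht]

/-- `j ≫ ε = j`: `ε` is the identity on the `G₀`-factor. [cite: Tate1997FiniteFlatGroupSchemes, (3.7)] -/
theorem self_comp_idem [MonObj H] [IsMonHom i] : j ≫ idem j i = j := comp_idem_of_fac j i j (𝟙 G₀) (Category.id_comp j)

/-- `i ≫ ε = 1`: `ε` kills the `H`-factor. [cite: Tate1997FiniteFlatGroupSchemes, (3.7)] -/
theorem compl_comp_idem [MonObj G₀] [IsMonHom j] : i ≫ idem j i = 1 := by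
  have h1 : i ≫ inv (mulMap j i) = lift (𝟙 H) (1 : H ⟶ G₀) := by
    rw [← cancel_mono (mulMap j i), Category.assoc, IsIso.inv_hom_id, Category.comp_id, lift_id_one_comp_mulMap]
  rw [idem, ← Category.assoc, h1, lift_snd_assoc, MonObj.one_comp]

/-- **`ε ≫ ε = ε`.** [cite: Tate1997FiniteFlatGroupSchemes, (3.7)] -/
theorem idem_comp_idem [MonObj H] [IsMonHom i] : idem j i ≫ idem j i = idem j i := by
  have h := self_comp_idem j i
  rw [idem] at h ⊢
  rw [Category.assoc, Category.assoc, h]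

/-- **THE FIXED POINTS OF `ε` ARE THE POINTS OF `G₀`**: `t ≫ ε = t` iff `t` factors through `j` (the factor is then unique, `j` mono).
[cite: Tate1997FiniteFlatGroupSchemes, (3.7)] [cite: GortzWedhorn2020, Definition 4.45 (2), p. 117] -/
theorem comp_idem_eq_self_iff [MonObj H] [IsMonHom i] {T : C} (t : T ⟶ G) : t ≫ idem j i = t ↔ ∃ t₀ : T ⟶ G₀, t₀ ≫ j = t := by
  refine ⟨fun h => ⟨t ≫ inv (mulMap j i) ≫ snd H G₀, ?_⟩, fun ⟨t₀, ht⟩ => comp_idem_of_fac j i t t₀ ht⟩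
  rw [Category.assoc, Category.assoc, ← idem, h]

end Core

section Hom

variable {C : Type u} [Category.{v} C] [CartesianMonoidalCategory C] [BraidedCategory C]
variable {G G₀ H : C} [GrpObj G] [IsCommMonObj G] [GrpObj G₀] [GrpObj H] (j : G₀ ⟶ G) [IsMonHom j] (i : H ⟶ G) [IsMonHom i]

/-- For COMMUTATIVE `G` the multiplication map `m` is a homomorphism. [cite: Tate1997FiniteFlatGroupSchemes, (3.7)] -/
theorem isMonHom_mulMap : IsMonHom (mulMap j i) := by
  rw [mulMap]; infer_instance

variable [IsIso (mulMap j i)]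

/-- For COMMUTATIVE `G` the idempotent `ε` is a HOMOMORPHISM (inverse of a homomorphic iso, projection, `j`). [cite: Tate1997FiniteFlatGroupSchemes, (3.7)] -/
theorem isMonHom_idem : IsMonHom (idem j i) := by
  haveI : IsMonHom (asIso (mulMap j i)).hom := isMonHom_mulMap j i
  haveI : IsMonHom (asIso (mulMap j i)).inv := inferInstance
  have h : idem j i = (asIso (mulMap j i)).inv ≫ snd H G₀ ≫ j := rfl
  rw [h]
  infer_instance

end Hom

section Naturality

variable {C : Type u} [Category.{v} C] [CartesianMonoidalCategory C] [BraidedCategory C]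
variable {G G₀ H : C} [GrpObj G] (j : G₀ ⟶ G) (i : H ⟶ G) [IsIso (mulMap j i)]

/-- **NATURALITY OF THE IDEMPOTENT.**  For two split group objects (`G'` commutative) `G ≅ H ⊗ G₀`, `G' ≅ H' ⊗ G₀'` and a homomorphism `φ : G → G'`
carrying `G₀` into `G₀'` (`hU`) and such that the `G₀'`-coordinate of `φ|_H` is trivial (`hH`): `φ ≫ ε' = ε ≫ φ`.  (Both sides are homomorphisms
agreeing on the two factors of `H ⊗ G₀ ⥲ G`.)  Over a perfect field `hU` and `hH` hold for EVERY homomorphism (`G₀` connected, `H` étale, §2).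
[cite: Tate1997FiniteFlatGroupSchemes, (3.7)] [cite: Waterhouse1979, §6.8] -/
theorem comp_idem_eq_idem_comp {G' G₀' H' : C} [GrpObj G'] [IsCommMonObj G'] [GrpObj G₀'] [GrpObj H']
    (j' : G₀' ⟶ G') [IsMonHom j'] (i' : H' ⟶ G') [IsMonHom i'] [IsIso (mulMap j' i')]
    (φ : G ⟶ G') [IsMonHom φ] (hU : ∃ ψ : G₀ ⟶ G₀', ψ ≫ j' = j ≫ φ)
    (hH : (i ≫ φ) ≫ inv (mulMap j' i') ≫ snd H' G₀' = 1) :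
    φ ≫ idem j' i' = idem j i ≫ φ := by
  obtain ⟨ψ, hψ⟩ := hU
  haveI := isMonHom_idem j' i'
  -- the two restrictions of `φ ≫ ε'`
  have hj : j ≫ φ ≫ idem j' i' = j ≫ φ := by
    rw [← Category.assoc, ← hψ, Category.assoc, self_comp_idem]
  have hi : i ≫ φ ≫ idem j' i' = 1 := by
    rw [idem, ← Category.assoc, ← Category.assoc (i ≫ φ), ← Category.assoc ((i ≫ φ) ≫ inv (mulMap j' i')),
      Category.assoc (i ≫ φ), hH, MonObj.one_comp]
  have hr : mulMap j i ≫ idem j i ≫ φ = snd H G₀ ≫ j ≫ φ := by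
    rw [← Category.assoc, mulMap_comp_idem, Category.assoc]
  rw [← cancel_epi (mulMap j i), hr]
  calc mulMap j i ≫ φ ≫ idem j' i'
      = (i ⊗ₘ j) ≫ ((φ ≫ idem j' i') ⊗ₘ (φ ≫ idem j' i')) ≫ μ[G'] := by
        rw [mulMap, Category.assoc, IsMonHom.mul_hom (f := φ ≫ idem j' i')]
    _ = ((i ≫ φ ≫ idem j' i') ⊗ₘ (j ≫ φ ≫ idem j' i')) ≫ μ[G'] := by
        rw [← Category.assoc, tensorHom_comp_tensorHom]
    _ = snd H G₀ ≫ j ≫ φ := by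
        rw [hi, hj, ← lift_fst_comp_snd_comp, MonObj.comp_one, Hom.one_def, MonObj.lift_comp_one_left]

end Naturality

end SplitIdempotent

/-! ## §2 Over an algebraically closed field: the étale complement of the unit component; naturality for every homomorphism -/

section Field

variable {k : Type u} [Field k] [IsAlgClosed k]

/-- **A finite group scheme over a field has FINITELY MANY `k`-POINTS** (`#G(k) · dim Γ(G⁰) = dim Γ(G) < ∞`, ★ `finrank_alg_eq_natCard_sections_mul`).
[cite: Tate1997FiniteFlatGroupSchemes, (3.7)] -/
theorem finite_sections_of_unitComponent (G G₀ : Over (Spec (.of k))) [GrpObj G] [GrpObj G₀] (j : G₀ ⟶ G) [IsFinite G.hom]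
    [IsMonHom j] [IsOpenImmersion j.left] [IsClosedImmersion j.left] [ConnectedSpace ↥G₀.left] :
    Finite (𝟙_ (Over (Spec (.of k))) ⟶ G) := by
  haveI : IsAffine G.left := AffineGroupScheme.isAffine_left_of_isAffineHom G
  haveI : Module.Finite k (AffineGroupScheme.Alg G) := AffineGroupScheme.Alg.moduleFinite G
  haveI : Nontrivial (AffineGroupScheme.Alg G) := nontrivial_alg_of_section G η[G]
  refine Nat.finite_of_card_ne_zero fun h0 => ?_
  have h := finrank_alg_eq_natCard_sections_mul G G₀ j
  rw [h0, zero_mul] at h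
  exact Module.finrank_pos.ne' h

/-- **A CONNECTED finite group scheme over `k = k̄` has EXACTLY ONE `k`-point** (its own unit component is itself: `dim Γ(G) = #G(k) · dim Γ(G)`).
[cite: Tate1997FiniteFlatGroupSchemes, (3.7)] -/
theorem subsingleton_sections_of_connectedSpace (G : Over (Spec (.of k))) [GrpObj G] [IsFinite G.hom] [ConnectedSpace ↥G.left] :
    Subsingleton (𝟙_ (Over (Spec (.of k))) ⟶ G) := by
  haveI : IsAffine G.left := AffineGroupScheme.isAffine_left_of_isAffineHom G
  haveI : Module.Finite k (AffineGroupScheme.Alg G) := AffineGroupScheme.Alg.moduleFinite G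
  haveI : Nontrivial (AffineGroupScheme.Alg G) := nontrivial_alg_of_section G η[G]
  haveI : IsOpenImmersion (𝟙 G : G ⟶ G).left := by rw [Over.id_left]; infer_instance
  haveI : IsClosedImmersion (𝟙 G : G ⟶ G).left := by rw [Over.id_left]; infer_instance
  haveI := finite_sections_of_unitComponent G G (𝟙 G)
  have h := finrank_alg_eq_natCard_sections_mul G G (𝟙 G)
  have hcard : Nat.card (𝟙_ (Over (Spec (.of k))) ⟶ G) = 1 := by
    have hpos : 0 < Module.finrank k (AffineGroupScheme.Alg G) := Module.finrank_pos
    conv_lhs at h => rw [← one_mul (Module.finrank k (AffineGroupScheme.Alg G))]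
    exact (Nat.eq_of_mul_eq_mul_right hpos h).symm
  exact (Nat.card_eq_one_iff_unique.mp hcard).1

/-- **THE ÉTALE COMPLEMENT.**  Over an algebraically closed field `k`, next to a unit component `j : G₀ ↪ G` of a FINITE group scheme `G`
(homomorphic open-and-closed immersion, `G₀` connected) there is a closed subgroup scheme `i : H ↪ G`, FINITE ÉTALE over `k` (the subgroup of all
`k`-points, ★ `exists_etale_closedSubgroup_of_points`), of COMPLEMENTARY RANK `rk H · rk G₀ = rk G` — so that ★ `isIso_tensorHom_comp_mul_of_etale`
applies: `H ⊗ G₀ ⥲ G` when `G` is commutative. [cite: Tate1997FiniteFlatGroupSchemes, (3.7)] [cite: Waterhouse1979, §6.8] -/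
theorem exists_etaleComplement (G G₀ : Over (Spec (.of k))) [GrpObj G] [GrpObj G₀] (j : G₀ ⟶ G) [IsFinite G.hom]
    [IsMonHom j] [IsOpenImmersion j.left] [IsClosedImmersion j.left] [ConnectedSpace ↥G₀.left] :
    ∃ (H : Over (Spec (.of k))) (_ : GrpObj H) (i : H ⟶ G), IsMonHom i ∧ IsClosedImmersion i.left ∧ IsFinite H.hom ∧ Etale H.hom ∧
      ∀ s, H.hom.finrank s * G₀.hom.finrank s = G.hom.finrank s := by
  haveI : IsAffine G.left := AffineGroupScheme.isAffine_left_of_isAffineHom G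
  haveI : IsFinite G₀.hom := (isFinite_and_flat_of_immersions j).1
  haveI := finite_sections_of_unitComponent G G₀ j
  -- the family of ALL `k`-points, read as `specOver k k`-points
  let u : (𝟙_ (Over (Spec (.of k))) ⟶ G) → (Literature.AlgebraicGeometry.Motives.specOver k k ⟶ G) :=
    fun s => (AffineGroupScheme.unitIsoSpecOver (R := k)).inv ≫ s
  have hu : Function.Injective u := fun s t h => by simpa [u, cancel_epi] using h
  have hπ := FrobKillSS.surjective_pi_ptEquiv_of_injective G u hu
  obtain ⟨H, GH, c, hc, hci, hfin, het, hpts⟩ := AffineGroupScheme.exists_etale_closedSubgroup_of_points G u hπ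
    ⟨1, by simp only [u, MonObj.comp_one]⟩ (fun s t => ⟨s * t, by simp only [u, MonObj.comp_mul]⟩)
    fun s => ⟨s⁻¹, by simp only [u, GrpObj.comp_inv]⟩
  refine ⟨H, GH, c, hc, hci, hfin, het, fun s => ?_⟩
  -- `#H(k) = #G(k)`: every point of `G` lifts to `H`, uniquely (`c` mono)
  haveI : Mono c := by haveI : Mono c.left := inferInstance; exact Over.mono_of_mono_left _
  have hbij : Nat.card (𝟙_ (Over (Spec (.of k))) ⟶ H) = Nat.card (𝟙_ (Over (Spec (.of k))) ⟶ G) := by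
    refine Nat.card_congr (Equiv.ofBijective (fun x => x ≫ c) ⟨fun x y h => (cancel_mono c).mp h, fun w => ?_⟩)
    obtain ⟨x, hx⟩ := (hpts (u w)).2 ⟨w, rfl⟩
    refine ⟨(AffineGroupScheme.unitIsoSpecOver (R := k)).hom ≫ x, ?_⟩
    change ((AffineGroupScheme.unitIsoSpecOver (R := k)).hom ≫ x) ≫ c = w
    rw [Category.assoc, hx]
    exact (AffineGroupScheme.unitIsoSpecOver (R := k)).hom_inv_id_assoc w
  -- ranks
  haveI : IsAffine H.left := AffineGroupScheme.isAffine_left_of_isAffineHom H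
  have hH : H.hom.finrank s = Nat.card (𝟙_ (Over (Spec (.of k))) ⟶ G) := by
    rw [hom_finrank_eq_finrank_alg H s, ← hbij]
    exact (natCard_hom_eq_finrank_of_etale H).symm
  rw [hH, hom_finrank_eq_finrank_alg G s, hom_finrank_eq_finrank_alg G₀ s]
  exact (finrank_alg_eq_natCard_sections_mul G G₀ j).symm

/-- **NATURALITY OVER `k̄` FOR EVERY HOMOMORPHISM.**  Let `G, G'` be finite COMMUTATIVE group schemes over an algebraically closed field, split
as `H ⊗ G₀ ⥲ G`, `H' ⊗ G₀' ⥲ G'` by unit components `j, j'` (connected) and closed étale subgroups `i, i'`.  Then EVERY homomorphism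
`φ : G → G'` intertwines the idempotents: `φ ≫ ε' = ε ≫ φ` — `φ(G₀) ⊆ G₀'` (★ `existsUnique_fac_hom`: connected through the unit component) and
`H → G' → G₀'` is trivial (a morphism from a finite étale `k̄`-scheme is determined by its values on `k`-points, ★ `hom_ext_of_sections`, and the
connected `G₀'` has one `k`-point). [cite: Tate1997FiniteFlatGroupSchemes, (3.7)] [cite: Waterhouse1979, §6.8] -/
theorem comp_idem_eq_idem_comp_of_hom {G G₀ H G' G₀' H' : Over (Spec (.of k))} [GrpObj G] [IsCommMonObj G] [GrpObj G₀] [GrpObj H]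
    [GrpObj G'] [IsCommMonObj G'] [GrpObj G₀'] [GrpObj H']
    (j : G₀ ⟶ G) [IsMonHom j] [IsOpenImmersion j.left] [IsClosedImmersion j.left] [ConnectedSpace ↥G₀.left]
    (i : H ⟶ G) [IsMonHom i] [IsFinite H.hom] [Etale H.hom] [IsIso (SplitIdempotent.mulMap j i)]
    (j' : G₀' ⟶ G') [IsMonHom j'] [IsOpenImmersion j'.left] [IsClosedImmersion j'.left] [ConnectedSpace ↥G₀'.left] [IsFinite G'.hom]
    (i' : H' ⟶ G') [IsMonHom i'] [IsIso (SplitIdempotent.mulMap j' i')]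
    (φ : G ⟶ G') [IsMonHom φ] :
    φ ≫ SplitIdempotent.idem j' i' = SplitIdempotent.idem j i ≫ φ := by
  haveI : Nonempty ↥(𝟙_ (Over (Spec (.of k)))).left := ⟨(IsLocalRing.closedPoint k : PrimeSpectrum k)⟩
  haveI : IsFinite G₀'.hom := (isFinite_and_flat_of_immersions j').1
  refine SplitIdempotent.comp_idem_eq_idem_comp j i j' i' φ ?_ ?_
  · obtain ⟨ψ, hψ, -⟩ := existsUnique_fac_hom j' (j ≫ φ)
    exact ⟨ψ, hψ⟩
  · haveI := subsingleton_sections_of_connectedSpace G₀'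
    exact EtaleGroupSchemeConstant.hom_ext_of_sections H _ _ fun s => Subsingleton.elim _ _

end Field

/-! ## §3 The packaged existence: the connected–étale idempotent of a finite commutative group scheme over `k̄` -/

section Package

variable {k : Type u} [Field k] [IsAlgClosed k]

/-- **THE CONNECTED–ÉTALE IDEMPOTENT EXISTS.**  For a FINITE COMMUTATIVE group scheme `G` over an algebraically closed field `k` there are a unit
component `j : G₀ ↪ G` (homomorphic open-and-closed immersion with connected source, ★ `exists_unitComponent`), a closed finite étale subgroup
`i : H ↪ G` with `(i ⊗ j) ≫ μ : H ⊗ G₀ ⥲ G` an ISOMORPHISM (★ `isIso_tensorHom_comp_mul_of_etale`), and hence the idempotent homomorphism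
`ε := SplitIdempotent.idem j i` of `G` (`ε ≫ ε = ε`) whose fixed points are exactly the points of `G₀`: `t ≫ ε = t ↔ t` factors through `j`.
[cite: Tate1997FiniteFlatGroupSchemes, (3.7)] [cite: Waterhouse1979, §6.8] -/
theorem exists_connectedEtaleSplitting (G : Over (Spec (.of k))) [GrpObj G] [IsCommMonObj G] [IsFinite G.hom] :
    ∃ (G₀ : Over (Spec (.of k))) (_ : GrpObj G₀) (j : G₀ ⟶ G) (H : Over (Spec (.of k))) (_ : GrpObj H) (i : H ⟶ G),
      (IsMonHom j ∧ IsOpenImmersion j.left ∧ IsClosedImmersion j.left ∧ ConnectedSpace ↥G₀.left) ∧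
      (IsMonHom i ∧ IsClosedImmersion i.left ∧ IsFinite H.hom ∧ Etale H.hom) ∧ IsIso (SplitIdempotent.mulMap j i) := by
  obtain ⟨G₀, GG₀, j, hj, hjo, hjc, hconn⟩ := UnitComponentClopen.exists_unitComponent k G inferInstance
  haveI := hj
  obtain ⟨H, GH, i, hi, hic, hfin, het, hrk⟩ := exists_etaleComplement G G₀ j
  haveI := hi
  exact ⟨G₀, GG₀, j, H, GH, i, ⟨hj, hjo, hjc, hconn⟩, ⟨hi, hic, hfin, het⟩, isIso_tensorHom_comp_mul_of_etale j i hrk⟩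

/-- **A CONNECTED–ÉTALE SPLITTING of a finite commutative group scheme `G` over `k`** — the DATA `G₀ ↪ G ↩ H` of §3 packaged as a record
(so that consumers can name «the» unit component and «the» étale part of each layer of a Barsotti–Tate group by `Classical.choice`): a unit
component `j : G₀ ↪ G` (homomorphic open-and-closed immersion, `G₀` connected), a closed finite étale subgroup `i : H ↪ G`, and the splitting
isomorphism `(i ⊗ j) ≫ μ : H ⊗ G₀ ⥲ G`.  Group structures are FIELDS (bind with `letI := S.grpObj₀`); no instance is declared.  Nothing is asserted
by declaring the record; its inhabitation is `nonempty_connectedEtaleSplitting`. [cite: Tate1997FiniteFlatGroupSchemes, (3.7)] [cite: Waterhouse1979, §6.8] -/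
structure ConnectedEtaleSplitting (G : Over (Spec (.of k))) [GrpObj G] where
  /-- the unit component `G₀ = G⁰` -/
  G₀ : Over (Spec (.of k))
  /-- its group structure -/
  grpObj₀ : GrpObj G₀
  /-- the inclusion `j : G⁰ ↪ G` … -/
  j : G₀ ⟶ G
  /-- … a homomorphism … -/
  isMonHom_j : letI := grpObj₀; IsMonHom j
  /-- … an open immersion … -/
  isOpenImmersion_j : IsOpenImmersion j.left
  /-- … and a closed immersion, … -/
  isClosedImmersion_j : IsClosedImmersion j.left
  /-- … with connected source -/
  connectedSpace_G₀ : ConnectedSpace ↥G₀.left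
  /-- the étale part `H = G_red` (the subgroup of all `k`-points) -/
  H : Over (Spec (.of k))
  /-- its group structure -/
  grpObjH : GrpObj H
  /-- the inclusion `i : H ↪ G` … -/
  i : H ⟶ G
  /-- … a homomorphism … -/
  isMonHom_i : letI := grpObjH; IsMonHom i
  /-- … and a closed immersion; … -/
  isClosedImmersion_i : IsClosedImmersion i.left
  /-- … `H → Spec k` finite … -/
  isFinite_H : IsFinite H.hom
  /-- … and étale -/
  etale_H : Etale H.hom
  /-- the splitting `(i ⊗ j) ≫ μ : H ⊗ G₀ ⥲ G` is an isomorphism -/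
  isIso_mulMap : IsIso (SplitIdempotent.mulMap j i)

/-- **Every finite commutative group scheme over an algebraically closed field HAS a connected–étale splitting** (§3 repackaged).
[cite: Tate1997FiniteFlatGroupSchemes, (3.7)] [cite: Waterhouse1979, §6.8] -/
theorem nonempty_connectedEtaleSplitting (G : Over (Spec (.of k))) [GrpObj G] [IsCommMonObj G] [IsFinite G.hom] :
    Nonempty (ConnectedEtaleSplitting G) := by
  obtain ⟨G₀, GG₀, j, H, GH, i, ⟨hj, hjo, hjc, hconn⟩, ⟨hi, hic, hfin, het⟩, hiso⟩ := exists_connectedEtaleSplitting G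
  exact ⟨⟨G₀, GG₀, j, hj, hjo, hjc, hconn, H, GH, i, hi, hic, hfin, het, hiso⟩⟩

namespace ConnectedEtaleSplitting

variable {G : Over (Spec (.of k))} [GrpObj G] (S : ConnectedEtaleSplitting G)

/-- **The connected–étale idempotent `ε_S := idem j i` of a splitting.** [cite: Tate1997FiniteFlatGroupSchemes, (3.7)] -/
def idem : G ⟶ G :=
  haveI := S.isIso_mulMap
  SplitIdempotent.idem S.j S.i

omit [IsAlgClosed k] in
/-- `ε_S ≫ ε_S = ε_S`. [cite: Tate1997FiniteFlatGroupSchemes, (3.7)] -/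
theorem idem_comp_idem : S.idem ≫ S.idem = S.idem := by
  letI := S.grpObjH; haveI := S.isMonHom_i; haveI := S.isIso_mulMap
  exact SplitIdempotent.idem_comp_idem S.j S.i

omit [IsAlgClosed k] in
/-- `ε_S` is a homomorphism (`G` commutative). [cite: Tate1997FiniteFlatGroupSchemes, (3.7)] -/
theorem isMonHom_idem [IsCommMonObj G] : IsMonHom S.idem := by
  letI := S.grpObj₀; letI := S.grpObjH; haveI := S.isMonHom_j; haveI := S.isMonHom_i; haveI := S.isIso_mulMap
  exact SplitIdempotent.isMonHom_idem S.j S.i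

omit [IsAlgClosed k] in
/-- `j ≫ ε_S = j`. [cite: Tate1997FiniteFlatGroupSchemes, (3.7)] -/
theorem j_comp_idem : S.j ≫ S.idem = S.j := by
  letI := S.grpObjH; haveI := S.isMonHom_i; haveI := S.isIso_mulMap
  exact SplitIdempotent.self_comp_idem S.j S.i

omit [IsAlgClosed k] in
/-- The fixed points of `ε_S` are exactly the points of the unit component `G₀`. [cite: Tate1997FiniteFlatGroupSchemes, (3.7)] -/
theorem comp_idem_eq_self_iff {T : Over (Spec (.of k))} (t : T ⟶ G) : t ≫ S.idem = t ↔ ∃ t₀ : T ⟶ S.G₀, t₀ ≫ S.j = t := by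
  letI := S.grpObjH; haveI := S.isMonHom_i; haveI := S.isIso_mulMap
  exact SplitIdempotent.comp_idem_eq_self_iff S.j S.i t

/-- **NATURALITY**: for EVERY homomorphism `φ : G → G'` of finite commutative group schemes over `k̄` and any splittings `S, S'`:
`φ ≫ ε_{S'} = ε_S ≫ φ`.  In particular (`φ = 𝟙`) the idempotent does not depend on the splitting. [cite: Tate1997FiniteFlatGroupSchemes, (3.7)] -/
theorem comp_idem_eq_idem_comp [IsCommMonObj G] {G' : Over (Spec (.of k))} [GrpObj G'] [IsCommMonObj G'] [IsFinite G'.hom]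
    (S' : ConnectedEtaleSplitting G') (φ : G ⟶ G') [IsMonHom φ] : φ ≫ S'.idem = S.idem ≫ φ := by
  letI := S.grpObj₀; letI := S.grpObjH; haveI := S.isMonHom_j; haveI := S.isMonHom_i; haveI := S.isIso_mulMap
  haveI := S.isOpenImmersion_j; haveI := S.isClosedImmersion_j; haveI := S.connectedSpace_G₀; haveI := S.isFinite_H; haveI := S.etale_H
  letI := S'.grpObj₀; letI := S'.grpObjH; haveI := S'.isMonHom_j; haveI := S'.isMonHom_i; haveI := S'.isIso_mulMap
  haveI := S'.isOpenImmersion_j; haveI := S'.isClosedImmersion_j; haveI := S'.connectedSpace_G₀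
  exact comp_idem_eq_idem_comp_of_hom S.j S.i S'.j S'.i φ

/-- The idempotent is CANONICAL: two splittings of `G` give the same `ε`. [cite: Tate1997FiniteFlatGroupSchemes, (3.7)] -/
theorem idem_eq [IsCommMonObj G] [IsFinite G.hom] (S' : ConnectedEtaleSplitting G) : S'.idem = S.idem := by
  simpa only [Category.id_comp, Category.comp_id] using S.comp_idem_eq_idem_comp S' (𝟙 G)

end ConnectedEtaleSplitting

end Package

end Literature.AlgebraicGeometry.GroupSchemes

end
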